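import Literature.MathematicalPhysics.QuantumFieldTheory.Balaban1983to89.B1Ineq353Proof
import Literature.MathematicalPhysics.QuantumFieldTheory.Balaban1983to89.B1Eq31Concrete
import Literature.MathematicalPhysics.QuantumFieldTheory.Balaban1983to89.B1Eq214Concrete
import Literature.MathematicalPhysics.QuantumFieldTheory.Balaban1983to89.B2Prop22Proof
import Literature.MathematicalPhysics.QuantumFieldTheory.Balaban1983to89.HiggsCovariancePos

/-!
# `Balaban1983to89.B1Eq353SupNorm` — T. Bałaban, *(Higgs)₂,₃ quantum fields in a finite volume. I. A lower bound*,
# Commun. Math. Phys. **85** (1982) 603–626 [Balaban1982Higgs1]: the constant `c₁` of p. 621 — *"From (3.50) it follows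
# that the first term above and its covariant Laplacian can be estimated by c₁p₁(L^kε) with c₁ independent of k, ε"*
# (the first term of (3.53), `a_kG_k(Ã)Q_k^*(Ã)φ′` = the background field (3.29) of the fluctuation `φ′`) — DERIVED, at the
# CONCRETE (Higgs)₂,₃ carriers, from the sup-norm bound (2.25) of Proposition 2.1 for `G_k(Ã)` and the defining equation
# (2.20)/(2.22) of `G_k`: `c₁ = a_k·max{c₀, 1 + m²c₀(L^kε)² + a_kc₀}`; the input (H1) of `…B1Ineq353Proof.ineq353` thereby
# reduced to row B1.Prop2.1

statement-level skeleton of published theorems with citation tags; proofs where landed; nothing here is a claim about the Yang–Mills mass gap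

PDF held: `paper:balaban1982-cmp85-higgs23-i` (journal page = PDF page + 602); pp. 609–610 [PDF 7–8] ((2.11), (2.20), (2.22),
(2.25)), p. 617 [PDF 15] ((3.27)–(3.29)), pp. 621–622 [PDF 19–20] ((3.50), (3.53) and the sentence after it), read on the ×2
renders `run/shared/lean/pub/pub-balaban/b2b-balaban-ref1/pages/1982-cmp85-higgs23-I/1982-cmp85-higgs23-I-p007|p008|p015|p019|p020-x2.png`.

CITATION HEADER (lean-in-tree rule).  Cell `lit-balaban` (HOME `run/shared/lean/pub/lit-balaban/`), Phase-2 proof seat **p14**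
gen 8 (unit `lit-balaban-p14`); SKELETON rows **B1.Eq3.53** (r12: the in-proof expression (3.53) + its p. 622 bound; served
schematically by this seat's `…B1Ineq353Proof`, p244791, whose hypothesis (H1) `hfirst` is the sentence quoted in the title),
**B1.Eq3.29** (the background fields `A^{(k),ε}`, `φ^{(k),ε}`; typer `…B1Eq31Concrete.bgScalar`/`bgVec`), **B1.Eq2.20**
(`G^ε_k(Ω,A)`, typer `…HiggsCovariance.propagatorK`/`covOpK`/`projPk`), **B1.Prop2.1** (2.25) (the INPUT, displayed).  USED BY
NAME, never restated: `…B1LowerBound.bgField` (r14, (3.29) shape), `…HiggsCovariance.{covLaplacianN, avgQkLin, avgQkAdj,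
projPk, covOpK, propagatorK}`, `…HiggsCovariancePos.covOpK_propagatorK_apply` (typer), `…B2Prop22Proof.norm_avgQkAdj_apply`
(p17), `…B1Eq214Concrete.{blockSite, posInBlock, …}` (r14), `…B1Ineq353Proof.chi_k_of_ineq354` (this seat g3).

WHAT IS PRINTED (verbatim).  p. 621 [PDF 19], after (3.53): *"From (3.50) it follows that the first term above and its
covariant Laplacian can be estimated by c₁p₁(L^kε) with c₁ independent of k, ε."*; (3.50): *"χ(φ′) = Π_{x∈T₁^{(k)}} χ({|φ′(x)| ≦
p₁(L^kε)})"*; (3.29) p. 617: *"φ^{(k),ε} = a_k(L^kε)^{−2}G^ε_k(A^{(k),ε})Q^*_k(A^{(k),ε})φ"*; (2.20) p. 610: *"G^ε_k(Ω, A) =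
(−Δ^{ε,N}_{A,Ω} + m² + a_k(L^kε)^{−2}P_k(A))^{−1}, P_k(A) = Q_k^*(A)Q_k(A)"*; (2.11) p. 609: *"(Q_k(A)φ)(y) = Σ_{x∈B^k(y)} L^{−kd}
U(A(Γ^{(k)}_{y,x}))φ(x)"*; Prop. 2.1 (2.25) p. 610: *"|(D^η_{A,μ}G_k(Ω, A)f)(x)|, |(G_k(Ω, A)f)(x)| ≦ c₀ exp(−δ₀ dist(x, supp f))‖f‖_∞
[…] For some simple sets Ω, e.g. for rectangular parallelepipeds, the inequalities hold without any restrictions on the points"*.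

THE READING (the print gives no further detail).  The first term of (3.53) is the background field (3.29) of `φ′` in the
background `Ã = A′^{(k)} + B^{(k+1)}`: `φ′^{(k)} = a_kℓ^{−2}G^ε_k(Ã)Q_k^*(Ã)φ′`, `ℓ = L^kε` (ε-units; unit lattice: `ℓ = 1`).
(i) `|(Q_k^*(Ã)φ′)(x)| = |φ′(x_k)|` (unitary transports); (ii) (2.25) for `G^ε_k(T_ε, Ã)` on the torus (rectangular: no `R₀`
restriction), `exp(−δ₀dist) ≦ 1` dropped, in ε-units ((2.22)): `‖G^ε_k(Ã)g‖_∞ ≦ c₀ℓ²‖g‖_∞` — the INPUT `hG` below, row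
B1.Prop2.1; hence `‖φ′^{(k)}‖_∞ ≦ a_kc₀‖φ′‖_∞`; (iii) (2.20) gives `−Δ^ε_{Ã}G^ε_k(Ã)g = g − m²G^ε_k(Ã)g − a_kℓ^{−2}P_k(Ã)G^ε_k(Ã)g`
(`covLaplacianN_propagatorK`) and `‖P_k(Ã)h‖_∞ ≦ ‖h‖_∞` (averages (2.11) of transported values over the `L^{kd}` points of a
block, `card_blockK`), so `‖Δ^ε_{Ã}φ′^{(k)}‖_∞ ≦ a_kℓ^{−2}(1 + m²c₀ℓ² + a_kc₀)‖φ′‖_∞`.  With `‖φ′‖_∞ ≦ ℓ^{−(d−2)/2}p₁(L^kε)` ((3.50)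
in ε-units) this is *"estimated by c₁p₁(L^kε)"* at the two threshold scales of (3.27)–(3.28), `c₁ = a_k·max{c₀, 1 + m²c₀ℓ² +
a_kc₀} ≦ a·max{c₀, 1 + m²c₀ + ac₀}` — independent of `k, ε` as printed (`c₁_uniform`).

WHAT THIS FILE PROVES (kernel-checked, zero `sorry`, NO new `def`, no new `Prop` fact; axioms standard).
* §1 `card_filter_blockOf`, **`card_blockK`**: `|B^k(y)| = L^{kd}` for `k ≦ K` ((1.17)–(1.20)).
* §2 at the CONCRETE carriers, every `A`, every `N`: `norm_avgQkLin_apply_le` (`‖Q_k(A)f‖_∞ ≦ ‖f‖_∞`, `k ≦ K`),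
  `norm_avgQkAdj_apply_le`, `norm_projPk_apply_le` (`‖P_k(A)h‖_∞ ≦ ‖h‖_∞`).
* §3 **`covLaplacianN_propagatorK`** (the identity (iii) from (2.20), `m² > 0`, `a_k ≧ 0`, any `Ω`) and
  `norm_covLaplacianN_propagatorK_le` (`‖Δ^ε_AG^ε_kg‖_∞ ≦ (1 + m²c₀ℓ² + a_kc₀)‖g‖_∞` GIVEN the (2.25)-bound `hG`).
* §4 **`norm_bgScalar_le`**, **`norm_covLaplacianN_bgScalar_le`**: the printed sentence for the concrete background field
  (3.29) `…B1Eq31Concrete.bgScalar` in ANY background `Ã` (GIVEN `hG` for `G^ε_k(T_ε,Ã)`), and `norm_bgScalar_le_thr` /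
  `norm_covLaplacianN_bgScalar_le_thr`: the two-scale form `≦ c₁·ℓ^{−(d∓2)/2}p₁` (`B1Eq31Concrete.thrF/thrLap`) under (3.50);
  the vector field `A^{(k),ε} = bgVec` is the instance `C = zeroCharge d`, `Ã = 0`, `m² ↤ μ₀²` (`toSite_bgVec`).
* §5 THE SCHEMATIC PLUG: **`hfirst_of_supBounds`** — over r14's abstract `bgField` (any real normed space), the four
  displayed facts (2.25)-sup-bound of `G`, `‖Q^*‖_{∞→∞} ≦ 1`, `‖P‖_{∞→∞} ≦ 1`, the (2.20)-identity for `Δ∘G` YIELD the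
  hypothesis (H1) `hfirst` of `B1Ineq353Proof.ineq353` VERBATIM with `c₁ = a_k(c₀ + 1 + m²c₀ + a_kc₀)`; and
  **`chi_k_of_ineq354_of_supBounds`** = this seat's `B1Ineq353Proof.chi_k_of_ineq354` (the p. 622 sentence «χ_k(φ′ + …ψ)
  is redundant») with (H1) so discharged.
HONEST SCOPE: the analytic input is (2.25) of Prop. 2.1 for `G_k(T, Ã)` at the background `Ã ≠ 0` (row B1.Prop2.1; in the
tree PROVED only at `A = 0` on nested boxes by the B4 sub-cell, `…B1Prop21ZeroField`) — displayed here as the hypothesis `hG`,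
never asserted; (H2) of `ineq353` (the expansion of the second term, p. 621 l. −3) is untouched.  Unit `lit-balaban-p14`
gen 8 (literature-prover-lit-balaban-p14-g8-0).
-/

open scoped BigOperators

namespace Literature.MathematicalPhysics.QuantumFieldTheory.Balaban1983to89.B1Eq353SupNorm

open Literature.MathematicalPhysics.QuantumFieldTheory.Balaban1983to89.HiggsLattice
open Literature.MathematicalPhysics.QuantumFieldTheory.Balaban1983to89.HiggsAveraging
open Literature.MathematicalPhysics.QuantumFieldTheory.Balaban1983to89.HiggsCovariance
open Literature.MathematicalPhysics.QuantumFieldTheory.Balaban1983to89.HiggsCovariancePos (covOpK_propagatorK_apply)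
open Literature.MathematicalPhysics.QuantumFieldTheory.Balaban1983to89.B1Eq214Concrete (blockSite posInBlock
  blockOf_blockSite posInBlock_blockSite blockSite_blockOf_posInBlock)
open Literature.MathematicalPhysics.QuantumFieldTheory.Balaban1983to89.B2Prop22Proof (norm_avgQkAdj_apply)
open Literature.MathematicalPhysics.QuantumFieldTheory.Balaban1983to89.B1LowerBound (bgField)

variable {P : Params}

/-! ## §1 `|B^k(y)| = L^{kd}` ((1.17)–(1.20)) -/

section Blocks

/-- One block `B(z) ⊂ T^{(k)}` of a coarse site `z ∈ T^{(k+1)}` has exactly `L^d` sites (`k < K`: the block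
parametrisation `B1Eq214Concrete.siteEquiv`, (1.17) `x_μ = Ly_μ + r_μ`). [cite: Balaban1982Higgs1, (1.17) p.606] -/
theorem card_filter_blockOf {k : ℕ} (hk : k < P.K) (z : Site P (k + 1)) :
    (Finset.univ.filter fun y : Site P k => blockOf y = z).card = P.L ^ P.d := by
  classical
  rw [← Fintype.card_subtype]
  let e : {y : Site P k // blockOf y = z} ≃ (Fin P.d → Fin P.L) :=
    { toFun := fun y => posInBlock y.1
      invFun := fun r => ⟨blockSite z r, blockOf_blockSite hk z r⟩
      left_inv := fun y => by
        apply Subtype.ext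
        have h := blockSite_blockOf_posInBlock hk y.1
        rw [y.2] at h
        exact h
      right_inv := fun r => posInBlock_blockSite hk z r }
  rw [Fintype.card_congr e, Fintype.card_pi, Finset.prod_const, Fintype.card_fin, Finset.card_univ, Fintype.card_fin]

/-- **`|B^k(y)| = L^{kd}`** for `y ∈ T^{(k)}`, `k ≦ K` ((1.20) p. 607: `T_ε = B^k(T^{(k)})`, each `B^k(y)` the union of the
`L^d` blocks `B^{k−1}(y′)`, `y′ ∈ B(y)`). [cite: Balaban1982Higgs1, (1.20) p.607] -/
theorem card_blockK : ∀ {k : ℕ}, k ≤ P.K → ∀ y : Site P k, (blockK k y).card = P.L ^ (k * P.d)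
  | 0, _, y => by
    have h : blockK (P := P) 0 y = {y} := by ext x; rw [mem_blockK, Finset.mem_singleton]; rfl
    rw [h, Finset.card_singleton, zero_mul, pow_zero]
  | k + 1, hk, z => by
    classical
    have hk' : k < P.K := by omega
    have H : ∀ x ∈ blockK (k + 1) z, blockIter k x ∈ (Finset.univ.filter fun y : Site P k => blockOf y = z) := by
      intro x hx
      rw [Finset.mem_filter]
      exact ⟨Finset.mem_univ _, (mem_blockK (k + 1) z x).1 hx⟩
    rw [Finset.card_eq_sum_card_fiberwise H]
    have hfib : ∀ y ∈ (Finset.univ.filter fun y : Site P k => blockOf y = z),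
        ((blockK (k + 1) z).filter fun x => blockIter k x = y).card = P.L ^ (k * P.d) := by
      intro y hy
      rw [Finset.mem_filter] at hy
      have hset : ((blockK (k + 1) z).filter fun x => blockIter k x = y) = blockK k y := by
        ext x
        rw [Finset.mem_filter, mem_blockK, mem_blockK]
        exact ⟨fun h => h.2, fun h => ⟨show blockOf (blockIter k x) = z by rw [h, hy.2], h⟩⟩
      rw [hset]
      exact card_blockK hk'.le y
    rw [Finset.sum_congr rfl hfib, Finset.sum_const, card_filter_blockOf hk' z, smul_eq_mul, ← pow_add]
    congr 1
    ring

end Blocks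

/-! ## §2 Sup-norm bounds of the averaging operators `Q_k(A)`, `Q_k^*(A)`, `P_k(A)` (every `A`) -/

section Averaging

variable {N : ℕ} (C : ChargeData N) (A : VecField P 0)

/-- **`‖Q_k(A)f‖_∞ ≦ ‖f‖_∞`** (`k ≦ K`): `(Q_k(A)f)(y)` averages the `L^{kd}` unitarily transported values
`U(A(Γ^{(k)}_{y,x}))f(x)`, `x ∈ B^k(y)` ((2.11); `|Uv| = |v|` p. 605). [cite: Balaban1982Higgs1, (2.11) p.609] -/
theorem norm_avgQkLin_apply_le {k : ℕ} (hk : k ≤ P.K) (f : ScalarField P 0 N) {M : ℝ} (hf : ∀ x, ‖f x‖ ≤ M)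
    (y : Site P k) : ‖avgQkLin C A k f y‖ ≤ M := by
  rw [avgQkLin_apply, avgQk_apply, norm_smul, norm_inv, norm_pow, Real.norm_natCast]
  have hL : (0 : ℝ) < (P.L : ℝ) ^ (k * P.d) := pow_pos (by exact_mod_cast P.hL) _
  have hsum : ‖∑ x ∈ blockK k y, C.U (P.mesh 0) (multiContourSum A k x) (f x)‖ ≤ (P.L : ℝ) ^ (k * P.d) * M := by
    calc ‖∑ x ∈ blockK k y, C.U (P.mesh 0) (multiContourSum A k x) (f x)‖
        ≤ ∑ x ∈ blockK k y, ‖C.U (P.mesh 0) (multiContourSum A k x) (f x)‖ := norm_sum_le _ _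
      _ ≤ ∑ _x ∈ blockK k y, M := Finset.sum_le_sum fun x _ => by
          rw [ContinuousLinearMap.norm_map_of_mem_unitary (C.U_mem_unitary _ _)]
          exact hf x
      _ = (P.L : ℝ) ^ (k * P.d) * M := by
          rw [Finset.sum_const, card_blockK hk y, nsmul_eq_mul]
          push_cast
          ring
  calc ((P.L : ℝ) ^ (k * P.d))⁻¹ * ‖∑ x ∈ blockK k y, C.U (P.mesh 0) (multiContourSum A k x) (f x)‖
      ≤ ((P.L : ℝ) ^ (k * P.d))⁻¹ * ((P.L : ℝ) ^ (k * P.d) * M) :=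
        mul_le_mul_of_nonneg_left hsum (inv_nonneg.2 hL.le)
    _ = M := by field_simp

/-- **`‖Q_k^*(A)ψ‖_∞ ≦ ‖ψ‖_∞`**: `|(Q_k^*(A)ψ)(x)| = |ψ(x_k)|` (p17's `norm_avgQkAdj_apply`; unitary transports).
[cite: Balaban1982Higgs1, (2.20) p.610] -/
theorem norm_avgQkAdj_apply_le (k : ℕ) (ψ : ScalarField P k N) {M : ℝ} (hψ : ∀ y, ‖ψ y‖ ≤ M) (x : Site P 0) :
    ‖avgQkAdj C A k ψ x‖ ≤ M := by
  rw [norm_avgQkAdj_apply]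
  exact hψ _

/-- **`‖P_k(A)h‖_∞ ≦ ‖h‖_∞`** for `P_k(A) = Q_k^*(A)Q_k(A)` ((2.20) p. 610), `k ≦ K`. [cite: Balaban1982Higgs1, (2.20) p.610] -/
theorem norm_projPk_apply_le {k : ℕ} (hk : k ≤ P.K) (h : ScalarField P 0 N) {M : ℝ} (hh : ∀ x, ‖h x‖ ≤ M)
    (x : Site P 0) : ‖projPk C A k h x‖ ≤ M := by
  rw [projPk, LinearMap.comp_apply]
  exact norm_avgQkAdj_apply_le C A k _ (norm_avgQkLin_apply_le C A hk h hh) x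

end Averaging

/-! ## §3 The covariant Laplacian of the propagator: the identity from (2.20) and its sup-norm consequence -/

section Propagator

variable {N : ℕ} (C : ChargeData N) (Ω : Finset (Site P 0)) (A : VecField P 0)

/-- **The defining equation (2.20) solved for the Laplacian**: `G^ε_k(Ω,A) = (−Δ^{ε,N}_{A,Ω} + m² + a_k(L^kε)^{−2}P_k(A))^{−1}`
gives, for every `g`, `(−Δ^{ε,N}_{A,Ω})G^ε_kg = g − m²G^ε_kg − a_k(L^kε)^{−2}P_k(A)G^ε_kg` (`m² > 0`, `a_k ≧ 0`: the operator is
invertible, `HiggsCovariancePos.covOpK_propagatorK_apply`). [cite: Balaban1982Higgs1, (2.20) p.610] -/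
theorem covLaplacianN_propagatorK {msq : ℝ} (hmsq : 0 < msq) (a : ℝ) (k : ℕ) (hak : 0 ≤ B1.aSeq a P.L k)
    (g : ScalarField P 0 N) :
    covLaplacianN C Ω A (propagatorK C Ω A msq a k g)
      = g - msq • propagatorK C Ω A msq a k g
          - (B1.aSeq a P.L k * ((P.mesh k)⁻¹ ^ 2)) • projPk C A k (propagatorK C Ω A msq a k g) := by
  have h := covOpK_propagatorK_apply C Ω A hmsq a k hak g
  simp only [covOpK, LinearMap.add_apply, LinearMap.smul_apply, LinearMap.id_coe, id_eq] at h
  rw [sub_sub, eq_sub_iff_add_eq, ← add_assoc]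
  exact h

/-- **`‖Δ^ε_AG^ε_kg‖_∞ ≦ (1 + m²c₀(L^kε)² + a_kc₀)‖g‖_∞` GIVEN the (2.25)-type sup bound of `G^ε_k(Ω,A)`** in ε-units,
`‖G^ε_kg‖_∞ ≦ c₀(L^kε)²‖g‖_∞` (hypothesis `hG` = Prop. 2.1 (2.25) for this `Ω, A`; displayed, not asserted), by the identity
of (2.20) and `‖P_k‖_{∞→∞} ≦ 1` (`k ≦ K`). [cite: Balaban1982Higgs1, (2.25) p.610; (2.20) p.610] -/
theorem norm_covLaplacianN_propagatorK_le {k : ℕ} (hk : k ≤ P.K) {msq : ℝ} (hmsq : 0 < msq) (a : ℝ)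
    (hak : 0 ≤ B1.aSeq a P.L k) {c₀ : ℝ}
    (hG : ∀ (g : ScalarField P 0 N) (M : ℝ), (∀ x, ‖g x‖ ≤ M) →
      ∀ x, ‖propagatorK C Ω A msq a k g x‖ ≤ c₀ * P.mesh k ^ 2 * M)
    (g : ScalarField P 0 N) {M : ℝ} (hg : ∀ x, ‖g x‖ ≤ M) (x : Site P 0) :
    ‖covLaplacianN C Ω A (propagatorK C Ω A msq a k g) x‖
      ≤ (1 + msq * c₀ * P.mesh k ^ 2 + B1.aSeq a P.L k * c₀) * M := by
  have hℓ : 0 < P.mesh k := P.mesh_pos k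
  have hGx : ∀ x, ‖propagatorK C Ω A msq a k g x‖ ≤ c₀ * P.mesh k ^ 2 * M := hG g M hg
  have hP : ‖projPk C A k (propagatorK C Ω A msq a k g) x‖ ≤ c₀ * P.mesh k ^ 2 * M :=
    norm_projPk_apply_le C A hk _ hGx x
  rw [covLaplacianN_propagatorK C Ω A hmsq a k hak g, Pi.sub_apply, Pi.sub_apply, Pi.smul_apply, Pi.smul_apply]
  have hc : 0 ≤ B1.aSeq a P.L k * ((P.mesh k)⁻¹ ^ 2) := mul_nonneg hak (pow_nonneg (inv_nonneg.2 hℓ.le) _)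
  have hinv : (P.mesh k)⁻¹ ^ 2 * P.mesh k ^ 2 = 1 := by
    rw [inv_pow, inv_mul_cancel₀ (pow_ne_zero _ hℓ.ne')]
  calc ‖g x - msq • propagatorK C Ω A msq a k g x
          - (B1.aSeq a P.L k * ((P.mesh k)⁻¹ ^ 2)) • projPk C A k (propagatorK C Ω A msq a k g) x‖
      ≤ ‖g x‖ + ‖msq • propagatorK C Ω A msq a k g x‖
          + ‖(B1.aSeq a P.L k * ((P.mesh k)⁻¹ ^ 2)) • projPk C A k (propagatorK C Ω A msq a k g) x‖ :=
        (norm_sub_le _ _).trans (add_le_add (norm_sub_le _ _) le_rfl)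
    _ ≤ M + msq * (c₀ * P.mesh k ^ 2 * M)
          + (B1.aSeq a P.L k * ((P.mesh k)⁻¹ ^ 2)) * (c₀ * P.mesh k ^ 2 * M) := by
        rw [norm_smul, norm_smul, Real.norm_of_nonneg hmsq.le, Real.norm_of_nonneg hc]
        exact add_le_add_three (hg x) (mul_le_mul_of_nonneg_left (hGx x) hmsq.le) (mul_le_mul_of_nonneg_left hP hc)
    _ = (1 + msq * c₀ * P.mesh k ^ 2 + B1.aSeq a P.L k * c₀) * M := by
        linear_combination (B1.aSeq a P.L k * c₀ * M) * hinv

end Propagator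

/-! ## §4 The printed sentence p. 621 for the concrete background field (3.29) -/

section FirstTerm

variable {N : ℕ} (C : ChargeData N) (Abg : VecField P 0)

/-- **The first term of (3.53), `φ′^{(k)} = a_k(L^kε)^{−2}G^ε_k(Ã)Q_k^*(Ã)φ′`, is bounded by `a_kc₀‖φ′‖_∞`** — from (2.25) for
`G^ε_k(T_ε, Ã)` (hypothesis `hG`, in ε-units) and `|(Q_k^*(Ã)φ′)(x)| = |φ′(x_k)|`; every background `Ã`, every `a` with
`a_k ≧ 0`. [cite: Balaban1982Higgs1, (3.53) p.621; (3.29) p.617; (2.25) p.610] -/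
theorem norm_bgScalar_le {k : ℕ} {msq : ℝ} (a : ℝ) (hak : 0 ≤ B1.aSeq a P.L k) {c₀ : ℝ}
    (hG : ∀ (g : ScalarField P 0 N) (M : ℝ), (∀ x, ‖g x‖ ≤ M) →
      ∀ x, ‖propagatorK C Finset.univ Abg msq a k g x‖ ≤ c₀ * P.mesh k ^ 2 * M)
    (φ : ScalarField P k N) {M : ℝ} (hφ : ∀ y, ‖φ y‖ ≤ M) (x : Site P 0) :
    ‖B1Eq31Concrete.bgScalar C msq a k Abg φ x‖ ≤ B1.aSeq a P.L k * c₀ * M := by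
  have hℓ : 0 < P.mesh k := P.mesh_pos k
  have hGx := hG (avgQkAdj C Abg k φ) M (norm_avgQkAdj_apply_le C Abg k φ hφ) x
  rw [B1Eq31Concrete.bgScalar_eq, Pi.smul_apply, norm_smul,
    Real.norm_of_nonneg (mul_nonneg hak (inv_nonneg.2 (pow_nonneg hℓ.le 2)))]
  calc B1.aSeq a P.L k * (P.mesh k ^ 2)⁻¹ * ‖propagatorK C Finset.univ Abg msq a k (avgQkAdj C Abg k φ) x‖
      ≤ B1.aSeq a P.L k * (P.mesh k ^ 2)⁻¹ * (c₀ * P.mesh k ^ 2 * M) :=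
        mul_le_mul_of_nonneg_left hGx (mul_nonneg hak (inv_nonneg.2 (pow_nonneg hℓ.le 2)))
    _ = B1.aSeq a P.L k * c₀ * M := by field_simp

/-- **… and its covariant Laplacian by `a_k(L^kε)^{−2}(1 + m²c₀(L^kε)² + a_kc₀)‖φ′‖_∞`** (`m² > 0`, `k ≦ K`; the identity of
(2.20) for `Δ^ε_{Ã}G^ε_k(Ã)` and `‖P_k(Ã)‖_{∞→∞} ≦ 1`). [cite: Balaban1982Higgs1, (3.53) p.621–622; (2.20), (2.25) p.610] -/
theorem norm_covLaplacianN_bgScalar_le {k : ℕ} (hk : k ≤ P.K) {msq : ℝ} (hmsq : 0 < msq) (a : ℝ)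
    (hak : 0 ≤ B1.aSeq a P.L k) {c₀ : ℝ}
    (hG : ∀ (g : ScalarField P 0 N) (M : ℝ), (∀ x, ‖g x‖ ≤ M) →
      ∀ x, ‖propagatorK C Finset.univ Abg msq a k g x‖ ≤ c₀ * P.mesh k ^ 2 * M)
    (φ : ScalarField P k N) {M : ℝ} (hφ : ∀ y, ‖φ y‖ ≤ M) (x : Site P 0) :
    ‖covLaplacianN C Finset.univ Abg (B1Eq31Concrete.bgScalar C msq a k Abg φ) x‖
      ≤ B1.aSeq a P.L k * (P.mesh k ^ 2)⁻¹ * (1 + msq * c₀ * P.mesh k ^ 2 + B1.aSeq a P.L k * c₀) * M := by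
  have hℓ : 0 < P.mesh k := P.mesh_pos k
  have hlap := norm_covLaplacianN_propagatorK_le C Finset.univ Abg hk hmsq a hak hG (avgQkAdj C Abg k φ)
    (norm_avgQkAdj_apply_le C Abg k φ hφ) x
  rw [B1Eq31Concrete.bgScalar_eq, map_smul, Pi.smul_apply, norm_smul,
    Real.norm_of_nonneg (mul_nonneg hak (inv_nonneg.2 (pow_nonneg hℓ.le 2)))]
  calc B1.aSeq a P.L k * (P.mesh k ^ 2)⁻¹
          * ‖covLaplacianN C Finset.univ Abg (propagatorK C Finset.univ Abg msq a k (avgQkAdj C Abg k φ)) x‖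
      ≤ B1.aSeq a P.L k * (P.mesh k ^ 2)⁻¹ * ((1 + msq * c₀ * P.mesh k ^ 2 + B1.aSeq a P.L k * c₀) * M) :=
        mul_le_mul_of_nonneg_left hlap (mul_nonneg hak (inv_nonneg.2 (pow_nonneg hℓ.le 2)))
    _ = B1.aSeq a P.L k * (P.mesh k ^ 2)⁻¹ * (1 + msq * c₀ * P.mesh k ^ 2 + B1.aSeq a P.L k * c₀) * M := by ring

/-- `ℓ^{−(d+2)/2}p = ℓ^{−2}·ℓ^{−(d−2)/2}p` (`B1Eq31Concrete.thrLap = ℓ⁻²·thrF`, `ℓ > 0`). [cite: Balaban1982Higgs1, (3.27)–(3.28) p.617] -/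
theorem thrLap_eq_inv_sq_mul_thrF (d : ℕ) {ℓ : ℝ} (hℓ : 0 < ℓ) (p : ℝ) :
    B1Eq31Concrete.thrLap d ℓ p = (ℓ ^ 2)⁻¹ * B1Eq31Concrete.thrF d ℓ p := by
  unfold B1Eq31Concrete.thrLap B1Eq31Concrete.thrF
  have h : ℓ ^ (-(((d : ℝ) + 2) / 2)) = (ℓ ^ 2)⁻¹ * ℓ ^ (-(((d : ℝ) - 2) / 2)) := by
    rw [show (-(((d : ℝ) + 2) / 2)) = (-2 : ℝ) + (-(((d : ℝ) - 2) / 2)) by ring, Real.rpow_add hℓ,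
      Real.rpow_neg hℓ.le, show (2 : ℝ) = ((2 : ℕ) : ℝ) by norm_num, Real.rpow_natCast]
  rw [h, mul_assoc]

/-- **The printed sentence, two-scale form (field)**: under the fluctuation restriction (3.50) in ε-units,
`|φ′(y)| ≦ (L^kε)^{−(d−2)/2}p₁(L^kε)` for all `y`, the first term of (3.53) satisfies
`|φ′^{(k)}(x)| ≦ (a_kc₀)·(L^kε)^{−(d−2)/2}p₁(L^kε)` — *"estimated by c₁p₁(L^kε)"* at the field scale of (3.28).
[cite: Balaban1982Higgs1, (3.53) p.621; (3.50) p.621; (3.28) p.617] -/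
theorem norm_bgScalar_le_thr {k : ℕ} {msq : ℝ} (a : ℝ) (hak : 0 ≤ B1.aSeq a P.L k) {c₀ p₁ : ℝ}
    (hG : ∀ (g : ScalarField P 0 N) (M : ℝ), (∀ x, ‖g x‖ ≤ M) →
      ∀ x, ‖propagatorK C Finset.univ Abg msq a k g x‖ ≤ c₀ * P.mesh k ^ 2 * M)
    (φ : ScalarField P k N) (hφ : ∀ y, ‖φ y‖ ≤ B1Eq31Concrete.thrF P.d (P.mesh k) p₁) (x : Site P 0) :
    ‖B1Eq31Concrete.bgScalar C msq a k Abg φ x‖ ≤ (B1.aSeq a P.L k * c₀) * B1Eq31Concrete.thrF P.d (P.mesh k) p₁ :=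
  norm_bgScalar_le C Abg a hak hG φ hφ x

/-- **The printed sentence, two-scale form (covariant Laplacian)**: under (3.50) in ε-units,
`|(Δ^ε_{Ã}φ′^{(k)})(x)| ≦ a_k(1 + m²c₀(L^kε)² + a_kc₀)·(L^kε)^{−(d+2)/2}p₁(L^kε)` — *"estimated by c₁p₁(L^kε)"* at the Laplacian
scale of (3.28). [cite: Balaban1982Higgs1, (3.53) p.621–622; (3.50) p.621; (3.28) p.617] -/
theorem norm_covLaplacianN_bgScalar_le_thr {k : ℕ} (hk : k ≤ P.K) {msq : ℝ} (hmsq : 0 < msq) (a : ℝ)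
    (hak : 0 ≤ B1.aSeq a P.L k) {c₀ p₁ : ℝ}
    (hG : ∀ (g : ScalarField P 0 N) (M : ℝ), (∀ x, ‖g x‖ ≤ M) →
      ∀ x, ‖propagatorK C Finset.univ Abg msq a k g x‖ ≤ c₀ * P.mesh k ^ 2 * M)
    (φ : ScalarField P k N) (hφ : ∀ y, ‖φ y‖ ≤ B1Eq31Concrete.thrF P.d (P.mesh k) p₁) (x : Site P 0) :
    ‖covLaplacianN C Finset.univ Abg (B1Eq31Concrete.bgScalar C msq a k Abg φ) x‖
      ≤ (B1.aSeq a P.L k * (1 + msq * c₀ * P.mesh k ^ 2 + B1.aSeq a P.L k * c₀))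
          * B1Eq31Concrete.thrLap P.d (P.mesh k) p₁ := by
  have h := norm_covLaplacianN_bgScalar_le C Abg hk hmsq a hak hG φ hφ x
  rw [thrLap_eq_inv_sq_mul_thrF P.d (P.mesh_pos k) p₁]
  calc ‖covLaplacianN C Finset.univ Abg (B1Eq31Concrete.bgScalar C msq a k Abg φ) x‖
      ≤ B1.aSeq a P.L k * (P.mesh k ^ 2)⁻¹ * (1 + msq * c₀ * P.mesh k ^ 2 + B1.aSeq a P.L k * c₀)
          * B1Eq31Concrete.thrF P.d (P.mesh k) p₁ := h
    _ = (B1.aSeq a P.L k * (1 + msq * c₀ * P.mesh k ^ 2 + B1.aSeq a P.L k * c₀))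
          * ((P.mesh k ^ 2)⁻¹ * B1Eq31Concrete.thrF P.d (P.mesh k) p₁) := by ring

/-- **`c₁` independent of `k, ε`** (p. 621 *"with c₁ independent of k, ε"*): for `L > 1`, `a > 0`, `L^kε ≦ 1`, `c₀ ≧ 0` both
constants above are dominated by `k, ε`-free ones — `a_kc₀ ≦ ac₀` and `a_k(1 + m²c₀(L^kε)² + a_kc₀) ≦ a(1 + m²c₀ + ac₀)`
(`k ≧ 1`: `a(1 − L⁻²) < a_k ≦ a`, `B1.aSeq_le`). [cite: Balaban1982Higgs1, (3.53) p.621; (2.15) p.609] -/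
theorem c₁_uniform {k : ℕ} (hk1 : 1 ≤ k) (hL : 1 < (P.L : ℝ)) {a msq c₀ : ℝ} (ha : 0 < a) (hmsq : 0 ≤ msq)
    (hc₀ : 0 ≤ c₀) (hℓ : P.mesh k ≤ 1) :
    B1.aSeq a P.L k * c₀ ≤ a * c₀ ∧
      B1.aSeq a P.L k * (1 + msq * c₀ * P.mesh k ^ 2 + B1.aSeq a P.L k * c₀) ≤ a * (1 + msq * c₀ + a * c₀) := by
  have hak : B1.aSeq a P.L k ≤ a := B1.aSeq_le ha hL k hk1
  have hak0 : 0 ≤ B1.aSeq a P.L k := (B1.aSeq_pos ha hL hk1).le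
  have hℓ2 : P.mesh k ^ 2 ≤ 1 := pow_le_one₀ (P.mesh_pos k).le hℓ
  refine ⟨mul_le_mul_of_nonneg_right hak hc₀, ?_⟩
  have h1 : 1 + msq * c₀ * P.mesh k ^ 2 + B1.aSeq a P.L k * c₀ ≤ 1 + msq * c₀ + a * c₀ := by
    have := mul_le_mul_of_nonneg_left hℓ2 (mul_nonneg hmsq hc₀)
    have := mul_le_mul_of_nonneg_right hak hc₀
    linarith
  exact mul_le_mul hak h1 (by positivity) ha.le

end FirstTerm

/-! ## §5 The schematic plug: (H1) of `B1Ineq353Proof.ineq353` from the four displayed facts -/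

section Schematic

variable {Z X V : Type} [NormedAddCommGroup V] [NormedSpace ℝ V]

/-- **(H1) FROM (2.25), (2.20) AND THE UNITARITY OF THE TRANSPORTS**, over r14's schematic (3.29)
`bgField a_k 1 G Q^*φ = a_k·G(Q^*φ)` on the unit lattice (as in `B1Ineq353Proof`): if `‖Gg‖_∞ ≦ c₀‖g‖_∞` ((2.25) on a
rectangle), `‖Q^*f‖_∞ ≦ ‖f‖_∞`, `‖Ph‖_∞ ≦ ‖h‖_∞` ((2.11): averages of unitaries) and `ΔGg = g − m²Gg − cPGg` ((2.20)/(2.22),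
`Δ` ↤ `−Δ^η_{Ã}`, `c` ↤ `a_k`, `m²` ↤ `m²(L^kε)²`), then for every `f` with `‖f‖_∞ ≦ M`:
`|a_kG Q^*f(z)| ≦ c₁M` and `|Δ(a_kGQ^*f)(z)| ≦ c₁M` with `c₁ = a_k(c₀ + 1 + m²c₀ + cc₀)` — EXACTLY the hypothesis `hfirst` of
`B1Ineq353Proof.ineq353`/`ineq353_vector`/`chi_k_of_ineq354`. [cite: Balaban1982Higgs1, (3.53) p.621; (2.25), (2.20) p.610] -/
theorem hfirst_of_supBounds (G lapA Pk : (Z → V) →ₗ[ℝ] (Z → V)) (Qsk : (X → V) →ₗ[ℝ] (Z → V))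
    {ak c₀ m2 c : ℝ} (hak : 0 ≤ ak) (hc₀ : 0 ≤ c₀) (hm2 : 0 ≤ m2) (hc : 0 ≤ c)
    (hG : ∀ (g : Z → V) (M : ℝ), (∀ z, ‖g z‖ ≤ M) → ∀ z, ‖G g z‖ ≤ c₀ * M)
    (hQ : ∀ (f : X → V) (M : ℝ), (∀ x, ‖f x‖ ≤ M) → ∀ z, ‖Qsk f z‖ ≤ M)
    (hP : ∀ (g : Z → V) (M : ℝ), (∀ z, ‖g z‖ ≤ M) → ∀ z, ‖Pk g z‖ ≤ M)
    (hres : ∀ g, lapA (G g) = g - m2 • G g - c • Pk (G g)) :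
    ∀ (f : X → V) (M : ℝ), (∀ x, ‖f x‖ ≤ M) → ∀ z,
      ‖bgField ak 1 G Qsk f z‖ ≤ (ak * (c₀ + 1 + m2 * c₀ + c * c₀)) * M ∧
        ‖lapA (bgField ak 1 G Qsk f) z‖ ≤ (ak * (c₀ + 1 + m2 * c₀ + c * c₀)) * M := by
  intro f M hf z
  have hQf : ∀ z, ‖Qsk f z‖ ≤ M := hQ f M hf
  have hGz : ∀ z, ‖G (Qsk f) z‖ ≤ c₀ * M := hG _ M hQf
  have hPz : ∀ z, ‖Pk (G (Qsk f)) z‖ ≤ c₀ * M := hP _ _ hGz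
  have hscal : ak * ((1 : ℝ) ^ 2)⁻¹ = ak := by norm_num
  simp only [bgField, hscal, map_smul, Pi.smul_apply, norm_smul, Real.norm_of_nonneg hak]
  constructor
  · calc ak * ‖G (Qsk f) z‖ ≤ ak * (c₀ * M) := mul_le_mul_of_nonneg_left (hGz z) hak
      _ ≤ (ak * (c₀ + 1 + m2 * c₀ + c * c₀)) * M := by
          have hM : 0 ≤ M := (norm_nonneg _).trans (hQf z)
          have : 0 ≤ (1 + m2 * c₀ + c * c₀) * M := by positivity
          nlinarith
  · rw [hres, Pi.sub_apply, Pi.sub_apply, Pi.smul_apply, Pi.smul_apply]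
    calc ak * ‖Qsk f z - m2 • G (Qsk f) z - c • Pk (G (Qsk f)) z‖
        ≤ ak * (‖Qsk f z‖ + ‖m2 • G (Qsk f) z‖ + ‖c • Pk (G (Qsk f)) z‖) :=
          mul_le_mul_of_nonneg_left ((norm_sub_le _ _).trans (add_le_add (norm_sub_le _ _) le_rfl)) hak
      _ ≤ ak * (M + m2 * (c₀ * M) + c * (c₀ * M)) := by
          rw [norm_smul, norm_smul, Real.norm_of_nonneg hm2, Real.norm_of_nonneg hc]
          exact mul_le_mul_of_nonneg_left (add_le_add_three (hQf z) (mul_le_mul_of_nonneg_left (hGz z) hm2)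
            (mul_le_mul_of_nonneg_left (hPz z) hc)) hak
      _ ≤ (ak * (c₀ + 1 + m2 * c₀ + c * c₀)) * M := by
          have : 0 ≤ c₀ * M := mul_nonneg hc₀ ((norm_nonneg _).trans (hQf z))
          nlinarith

open B1LowerBound B1Sect3Statements in
/-- **THE p. 622 SENTENCE WITH (H1) DISCHARGED**: this seat's `B1Ineq353Proof.chi_k_of_ineq354` («χ_{k+1}(ψ)χ(φ′) ⇒
χ_k(φ′ + aL⁻²C^{(k)}(B^{(k+1)})Q*(B^{(k+1)})ψ) = 1» once `c₁p₁ + pp + c₂ℓk^α ≦ pk`) with its hypothesis `hfirst` REPLACED by the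
four displayed facts of `hfirst_of_supBounds` — (2.25) for `G_k(Ã)`, `‖Q_k^*‖ ≦ 1`, `‖P_k‖ ≦ 1`, (2.20) — at
`c₁ = a_k(c₀ + 1 + m²c₀ + cc₀)`. [cite: Balaban1982Higgs1, (3.53)–(3.54) pp.621–622] -/
theorem chi_k_of_ineq354_of_supBounds {Y : Type} (G lapA lapB Pk : (Z → V) →ₗ[ℝ] (Z → V)) (Qsk : (X → V) →ₗ[ℝ] (Z → V))
    (Cc : (X → V) →ₗ[ℝ] (X → V)) (Qs : (Y → V) →ₗ[ℝ] (X → V)) (G1 : (Z → V) →ₗ[ℝ] (Z → V))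
    (Qs1 : (Y → V) →ₗ[ℝ] (Z → V))
    {ak ak1 a L c₀ m2 c c₂ ℓk α p1 pp pk : ℝ} {d : ℕ} {φ' : X → V} {ψ : Y → V} (hd : 2 ≤ d) (hL : 1 ≤ L)
    (hpp : 0 ≤ pp) (hak : 0 ≤ ak) (hc₀ : 0 ≤ c₀) (hm2 : 0 ≤ m2) (hc : 0 ≤ c)
    (h354 : (ak * (c₀ + 1 + m2 * c₀ + c * c₀)) * p1 + pp + c₂ * ℓk ^ α ≤ pk)
    (hG : ∀ (g : Z → V) (M : ℝ), (∀ z, ‖g z‖ ≤ M) → ∀ z, ‖G g z‖ ≤ c₀ * M)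
    (hQ : ∀ (f : X → V) (M : ℝ), (∀ x, ‖f x‖ ≤ M) → ∀ z, ‖Qsk f z‖ ≤ M)
    (hP : ∀ (g : Z → V) (M : ℝ), (∀ z, ‖g z‖ ≤ M) → ∀ z, ‖Pk g z‖ ≤ M)
    (hres : ∀ g, lapA (G g) = g - m2 • G g - c • Pk (G g))
    (hsecond : ∀ z, ‖(bgField ak 1 G Qsk ((a * (L ^ 2)⁻¹) • Cc (Qs ψ)) - bgField ak1 L G1 Qs1 ψ) z‖ ≤ c₂ * ℓk ^ α
      ∧ ‖(lapA (bgField ak 1 G Qsk ((a * (L ^ 2)⁻¹) • Cc (Qs ψ))) - lapB (bgField ak1 L G1 Qs1 ψ)) z‖ ≤ c₂ * ℓk ^ α)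
    (hchi : SmallFluct p1 (fun x => ‖φ' x‖))
    (hchi1 : ∀ z, SmallFieldAt d L pp ‖bgField ak1 L G1 Qs1 ψ z‖ ‖lapB (bgField ak1 L G1 Qs1 ψ) z‖) :
    SmallFieldUnit pk (fun z => ‖bgField ak 1 G Qsk (transl310 (a * (L ^ 2)⁻¹) Cc Qs φ' ψ) z‖)
      (fun z => ‖lapA (bgField ak 1 G Qsk (transl310 (a * (L ^ 2)⁻¹) Cc Qs φ' ψ)) z‖) :=
  B1Ineq353Proof.chi_k_of_ineq354 G lapA lapB Qsk Cc Qs G1 Qs1 hd hL hpp h354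
    (hfirst_of_supBounds G lapA Pk Qsk hak hc₀ hm2 hc hG hQ hP hres) hsecond hchi hchi1

end Schematic

end Literature.MathematicalPhysics.QuantumFieldTheory.Balaban1983to89.B1Eq353SupNorm
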